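import Mathlib.Analysis.InnerProductSpace.Projection.Basic
import Mathlib.Analysis.InnerProductSpace.Symmetric
import HarnessLib

/-!
# An eigenvector with a large eigenvalue is almost orthogonal to near-null vectors

Topic `Literature/Analysis/InnerProduct` (companion of `SubspaceLeakage`). Setting: an inner product
space `E` over `𝕜 = ℝ` or `ℂ`, a symmetric linear map `T`, an eigenvector `T u = ε u`.

* `norm_mul_norm_inner_le_of_eigenvector` — THE NEAR-NULL INEQUALITY: for every `v`,
  `‖ε‖ ‖⟪v, u⟫‖ ≤ ‖T v‖ ‖u‖` (pair `T u = ε u` with `v` and move `T` across: `ε ⟪v, u⟫ = ⟪T v, u⟫`).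
  So a unit eigenvector is orthogonal to any trial vector `v` up to `‖T v‖ / |ε|`: vectors on which
  `T` is small ("near-null", residual `‖T v‖`) cannot carry an eigenvector whose eigenvalue is large
  compared with that residual. It is the eigenvector-component form of the residual bounds for
  approximate invariant subspaces (Golub–Van Loan, *Matrix Computations* 4th ed. (2013), §8.1.3,
  Thm 8.1.13: `A Q₁ − Q₁ S = E₁` small forces eigenvalues of `S` near eigenvalues of `A`), recorded in
  the one-line form we use; elementary and folklore.
* `inner_eq_zero_of_eigenvector_of_apply_eq_zero` — the exact case: an eigenvector with `ε ≠ 0` is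
  orthogonal to `ker T`.
* `norm_starProjection_le_of_eigenvector` — SUBSPACE FORM: if `‖T v‖ ≤ ρ ‖v‖` on a subspace `V`
  carrying Mathlib's `Submodule.starProjection` then `‖P_V u‖ ≤ ρ ‖u‖ / ‖ε‖` (`ε ≠ 0`).

Motivation (pub-rhpf cell, THEORY-3 "intruder ⟂ transported prolate span"; mechanism/rigidity
campaign, no RH claims): the archimedean prolate span of the observatory is a span of NEAR-NULL
vectors of the window form, so the component of ANY eigenvector in it is bounded by
(null-residual of the span)/|eigenvalue| — a structural fact for every symmetric window matrix, which is
why near-orthogonality of a crossing (large-|ε|) eigenvector to that span carries no information beyond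
the size of its eigenvalue. Abstract linear algebra only; no definitions, no named facts; sorry-free.

## References
* G. H. Golub, C. F. Van Loan, *Matrix Computations*, 4th ed. (2013), §8.1.3, Thm 8.1.13–8.1.14
  (approximate invariant subspaces and their residuals). [GolubVanLoan2013]
-/

noncomputable section

open scoped InnerProductSpace

namespace Literature.Analysis.InnerProduct

variable {𝕜 : Type*} [RCLike 𝕜] {E : Type*} [NormedAddCommGroup E] [InnerProductSpace 𝕜 E]

/-- Pairing an eigenvector with a trial vector: `⟪T v, u⟫ = ε ⟪v, u⟫` for symmetric `T` and
`T u = ε u`. [folklore] -/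
theorem inner_apply_eigenvector_eq {T : E →ₗ[𝕜] E} (hT : T.IsSymmetric) {u : E} {ε : 𝕜}
    (hu : T u = ε • u) (v : E) : ⟪T v, u⟫_𝕜 = ε * ⟪v, u⟫_𝕜 := by
  rw [hT v u, hu, inner_smul_right]

/-- **Near-null inequality.** For symmetric `T`, `T u = ε u` and any `v`:
`‖ε‖ ‖⟪v, u⟫‖ ≤ ‖T v‖ ‖u‖`. [folklore] -/
theorem norm_mul_norm_inner_le_of_eigenvector {T : E →ₗ[𝕜] E} (hT : T.IsSymmetric) {u : E}
    {ε : 𝕜} (hu : T u = ε • u) (v : E) : ‖ε‖ * ‖⟪v, u⟫_𝕜‖ ≤ ‖T v‖ * ‖u‖ := by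
  rw [← norm_mul, ← inner_apply_eigenvector_eq hT hu v]
  exact norm_inner_le_norm _ _

/-- **Exact case.** An eigenvector with non-zero eigenvalue is orthogonal to every null vector of a
symmetric `T`. [folklore] -/
theorem inner_eq_zero_of_eigenvector_of_apply_eq_zero {T : E →ₗ[𝕜] E} (hT : T.IsSymmetric)
    {u v : E} {ε : 𝕜} (hu : T u = ε • u) (hε : ε ≠ 0) (hv : T v = 0) : ⟪v, u⟫_𝕜 = 0 := by
  have h := inner_apply_eigenvector_eq hT hu v
  rw [hv, inner_zero_left] at h
  rcases mul_eq_zero.mp h.symm with h' | h'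
  · exact absurd h' hε
  · exact h'

/-- **Near-null inequality, subspace form.** If `‖T v‖ ≤ ρ ‖v‖` for all `v` in a subspace `V` with an
orthogonal projection `P_V`, then every eigenvector `T u = ε u` with `ε ≠ 0` satisfies
`‖P_V u‖ ≤ ρ ‖u‖ / ‖ε‖` (residual form of Golub–Van Loan §8.1.3, Thm 8.1.13). [folklore] -/
theorem norm_starProjection_le_of_eigenvector (V : Submodule 𝕜 E) [V.HasOrthogonalProjection]
    {T : E →ₗ[𝕜] E} (hT : T.IsSymmetric) {u : E} {ε : 𝕜} (hu : T u = ε • u) (hε : ε ≠ 0)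
    {ρ : ℝ} (hρ : 0 ≤ ρ) (hρV : ∀ v ∈ V, ‖T v‖ ≤ ρ * ‖v‖) :
    ‖V.starProjection u‖ ≤ ρ * ‖u‖ / ‖ε‖ := by
  set p := V.starProjection u with hp
  have hεpos : 0 < ‖ε‖ := norm_pos_iff.mpr hε
  rw [le_div_iff₀ hεpos]
  -- `⟪p, u⟫ = ⟪p, p⟫` since `u - p ⊥ V ∋ p`
  have horth : ⟪p, u - p⟫_𝕜 = 0 := by
    rw [inner_eq_zero_symm]
    exact V.starProjection_inner_eq_zero u p (V.starProjection_apply_mem u)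
  have hpu : ⟪p, u⟫_𝕜 = ((‖p‖ : 𝕜)) ^ 2 := by
    have : u = p + (u - p) := by abel
    rw [this, inner_add_right, horth, add_zero, inner_self_eq_norm_sq_to_K]
  have key := norm_mul_norm_inner_le_of_eigenvector hT hu p
  rw [hpu, norm_pow, RCLike.norm_ofReal, abs_norm] at key
  -- key : ‖ε‖ * ‖p‖ ^ 2 ≤ ‖T p‖ * ‖u‖
  have hTp : ‖T p‖ ≤ ρ * ‖p‖ := hρV p (V.starProjection_apply_mem u)
  by_cases hp0 : ‖p‖ = 0
  · rw [hp0, zero_mul]; positivity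
  · have hppos : 0 < ‖p‖ := lt_of_le_of_ne (norm_nonneg _) (Ne.symm hp0)
    have h1 : ‖ε‖ * ‖p‖ ^ 2 ≤ ρ * ‖p‖ * ‖u‖ := by
      calc ‖ε‖ * ‖p‖ ^ 2 ≤ ‖T p‖ * ‖u‖ := key
        _ ≤ ρ * ‖p‖ * ‖u‖ := by gcongr
    have h2 : (‖p‖ * ‖ε‖) * ‖p‖ ≤ (ρ * ‖u‖) * ‖p‖ := by
      have e1 : ‖ε‖ * ‖p‖ ^ 2 = (‖p‖ * ‖ε‖) * ‖p‖ := by ring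
      have e2 : ρ * ‖p‖ * ‖u‖ = (ρ * ‖u‖) * ‖p‖ := by ring
      linarith
    exact le_of_mul_le_mul_right h2 hppos

end Literature.Analysis.InnerProduct

end
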